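import Mathlib.Analysis.SpecialFunctions.Trigonometric.Deriv
import Literature.Geometry.Lorentzian.Basic
import Literature.Geometry.Lorentzian.Causality
import HarnessLib

/-!
# Closed timelike curves in `ℝ³`: the chronology condition is a condition, not a theorem

`Literature.Geometry.Lorentzian.LorentzianMetric.IsChronological g τ` (file `Causality.lean`) is
O'Neill's **chronology condition** — "If `M` contains no closed timelike curves, we say that the
chronology condition holds on `M`" (O'Neill 1983, Ch. 14, p. 407) — i.e. the *definition* of a
causality condition on a time-oriented Lorentzian manifold `(M, g, τ)`, not a published theorem.
Its universal closure ("every time-oriented Lorentzian manifold is chronological", the shape a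
discharge `IsChronological_holds` would have) is **false**: every compact spacetime contains a
closed timelike curve (O'Neill 1983, Ch. 14, Lemma 14.10), and O'Neill's Exercise 14.8 (a)
(p. 438) asks for "a Lorentz metric on `ℝ³` for which there are many closed timelike curves".
This file solves that exercise inside the vendored formalism and records the refutation:

* `ChronologyViolation.bilin x = −ω_x ⊗ ω_x + dx ⊗ dx + dy ⊗ dy`, `ω_x = dt + 2 (x dy − y dx)`,
  on `E3 = ℝ³` with coordinates `t = x 0`, `x = x 1`, `y = x 2` (a polynomial, hence analytic,
  field of bilinear forms; the Cartesian `2+1`-dimensional core of the rotating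
  Gödel/Som–Raychaudhuri line elements `−(dt + Ω r² dφ)² + dr² + r² dφ²`, Hawking–Ellis 1973,
  §5.7); `bilin x = A_x^* η` for the unipotent shear `A_x v = (ω_x v, v¹, v²)` and the `2+1`
  Minkowski form `η`, so it is a Lorentzian scalar product at every point, `g(∂ₜ, ∂ₜ) = −1`;
* `ChronologyViolation.metric : LorentzianMetric 𝓘(ℝ, E3) ω E3` (smoothness of the section via
  `contMDiff_bilinSection`: on a normed space a field of bilinear forms is `C^n` as a section of
  `Hom(TF, Hom(TF, ℝ))` as soon as it is `C^n` as a map — the non-constant version of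
  `Minkowski.contMDiff_bilin`), and the time orientation `ChronologyViolation.timeOrientation = ∂ₜ`;
* the light cones tip over along the circles `t = 0`, `x² + y² = r²` (tangent `−y ∂ₓ + x ∂_y`,
  `g = r² (1 − 4 r²) < 0` for `r > 1/2`): the unit circle `circle s = (0, cos s, sin s)` is a
  closed future-directed timelike curve, `g(γ', γ') = −3`, `g(∂ₜ, γ') = −2`, `γ 0 = γ (2π)`
  (`isFutureTimelikeCurveOn_circle`);
* `ChronologyViolation.not_isChronological : ¬ metric.IsChronological timeOrientation`, and the
  refutation `LorentzianMetric.not_forall_isChronological` of the universal closure of the `def`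
  (it fails already for analytic metrics on `ℝ³`).

Mathlib has no Lorentzian causality theory; we use `EuclideanSpace.proj`/`single`,
`ContinuousLinearMap.smulRight` with `ContDiff.smulRight`, `Bundle.contMDiffAt_section`,
`hom_trivializationAt_apply`, `contMDiff_vectorSpace_iff_contDiff`, `hasMFDerivAt_iff_hasFDerivAt`.

## References

* B. O'Neill, *Semi-Riemannian geometry with applications to relativity*, Academic Press 1983,
  Ch. 14: p. 407 (chronology condition; Lemma 14.10: a compact spacetime contains a closed
  timelike curve), Exercise 14.8 (a), p. 438 (a Lorentz metric on `ℝ³` with closed timelike curves).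
* S. W. Hawking, G. F. R. Ellis, *The large scale structure of space-time*, CUP 1973, §5.7
  (Gödel's universe: closed timelike curves through every point), §6.4 (chronology condition).
-/

noncomputable section

open Bundle Set
open scoped Manifold ContDiff Topology

namespace Literature.Geometry.Lorentzian

namespace ChronologyViolation

/-! ### Covectors and bilinear forms on `E3` -/

/-- The coordinate covector `dx^μ : E3 →L[ℝ] ℝ`, `v ↦ v μ` (Mathlib's `EuclideanSpace.proj μ`);
`dx⁰ = dt`, `dx¹ = dx`, `dx² = dy`. O'Neill 1983, Ch. 1, p. 9 (coordinate one-forms). [folklore] -/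
abbrev dx (μ : Fin 3) : E3 →L[ℝ] ℝ := EuclideanSpace.proj μ

/-- The tensor product `α ⊗ β` of two covectors as a continuous bilinear form
`(v, w) ↦ α v * β w` (Mathlib's `ContinuousLinearMap.smulRight`). O'Neill 1983, Ch. 2, p. 36
(tensor products of one-forms). [folklore] -/
def tmul (α β : E3 →L[ℝ] ℝ) : E3 →L[ℝ] E3 →L[ℝ] ℝ := α.smulRight β

/-- `(α ⊗ β)(v, w) = α v * β w` (O'Neill 1983, Ch. 2, p. 36). [folklore] -/
@[simp]
theorem tmul_apply (α β : E3 →L[ℝ] ℝ) (v w : E3) : tmul α β v w = α v * β w := by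
  simp [tmul]

/-- The coordinate vector `∂_μ ∈ E3` (Mathlib's `EuclideanSpace.single μ 1`; `∂₀ = ∂ₜ`).
O'Neill 1983, Ch. 1, p. 8. [folklore] -/
abbrev basisVector (μ : Fin 3) : E3 := EuclideanSpace.single μ 1

/-- The **rotating coframe covector** `ω_x = dt + 2 (x dy − y dx)` at the point `x = (t, x, y)`,
i.e. `ω_x v = v⁰ + 2 x¹ v² − 2 x² v¹` (the Cartesian form of `dt + 2 r² dφ`). Compare the
Gödel/Som–Raychaudhuri line elements, Hawking–Ellis 1973, §5.7; O'Neill 1983, Exercise 14.8 (a). [cite: ONeillSemiRiemannian1983, Ch. 14, Exercise 14.8 (a), p. 438] -/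
def omega (x : E3) : E3 →L[ℝ] ℝ := dx 0 + (2 * x 1) • dx 2 - (2 * x 2) • dx 1

/-- `ω_x v = v⁰ + 2 x¹ v² − 2 x² v¹` (O'Neill 1983, Exercise 14.8 (a)). [cite: ONeillSemiRiemannian1983, Ch. 14, Exercise 14.8 (a), p. 438] -/
@[simp]
theorem omega_apply (x v : E3) : omega x v = v 0 + 2 * x 1 * v 2 - 2 * x 2 * v 1 := by
  simp [omega]

/-- `ω` is a polynomial (degree one) function of the point, hence analytic (O'Neill 1983, Exercise 14.8 (a)). [cite: ONeillSemiRiemannian1983, Ch. 14, Exercise 14.8 (a), p. 438] -/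
theorem contDiff_omega : ContDiff ℝ ω omega := by
  have hc : ∀ i : Fin 3, ContDiff ℝ ω (fun x : E3 ↦ x i) := fun i ↦ by
    rw [← EuclideanSpace.coe_proj ℝ]
    exact (EuclideanSpace.proj i : E3 →L[ℝ] ℝ).contDiff
  unfold omega
  exact (contDiff_const.add ((contDiff_const.mul (hc 1)).smul contDiff_const)).sub
    ((contDiff_const.mul (hc 2)).smul contDiff_const)

/-- The **tipping-light-cone bilinear form** `g_x = −ω_x ⊗ ω_x + dx ⊗ dx + dy ⊗ dy` on `E3 = ℝ³`,
a Lorentz metric on `ℝ³` with closed timelike curves (O'Neill 1983, Ch. 14, Exercise 14.8 (a),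
p. 438; the `2+1`-dimensional polynomial core of the Gödel/Som–Raychaudhuri rotating metrics,
Hawking–Ellis 1973, §5.7). [cite: ONeillSemiRiemannian1983, Ch. 14, Exercise 14.8 (a), p. 438] -/
def bilin (x : E3) : E3 →L[ℝ] E3 →L[ℝ] ℝ :=
  tmul (-omega x) (omega x) + tmul (dx 1) (dx 1) + tmul (dx 2) (dx 2)

/-- `g_x(v, w) = −ω_x(v) ω_x(w) + v¹ w¹ + v² w²` (O'Neill 1983, Exercise 14.8 (a)). [cite: ONeillSemiRiemannian1983, Ch. 14, Exercise 14.8 (a), p. 438] -/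
@[simp]
theorem bilin_apply (x v w : E3) :
    bilin x v w = -(omega x v * omega x w) + v 1 * w 1 + v 2 * w 2 := by
  simp only [bilin, add_apply, tmul_apply, neg_apply, neg_mul]
  rfl

/-- `g_x` is symmetric (O'Neill 1983, Ch. 3, Def. 3.1). [cite: ONeillSemiRiemannian1983, Ch. 3, Def. 3.1] -/
theorem bilin_symm (x v w : E3) : bilin x v w = bilin x w v := by
  simp only [bilin_apply]
  ring

/-- `ω_x(∂ₜ) = 1` (O'Neill 1983, Exercise 14.8 (a)). [cite: ONeillSemiRiemannian1983, Ch. 14, Exercise 14.8 (a), p. 438] -/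
@[simp]
theorem omega_basisVector_zero (x : E3) : omega x (basisVector 0) = 1 := by
  simp [omega_apply, Fin.ext_iff]

/-- `ω_x(∂ₓ) = −2 x²` (O'Neill 1983, Exercise 14.8 (a)). [cite: ONeillSemiRiemannian1983, Ch. 14, Exercise 14.8 (a), p. 438] -/
@[simp]
theorem omega_basisVector_one (x : E3) : omega x (basisVector 1) = -(2 * x 2) := by
  simp [omega_apply, Fin.ext_iff]

/-- `ω_x(∂_y) = 2 x¹` (O'Neill 1983, Exercise 14.8 (a)). [cite: ONeillSemiRiemannian1983, Ch. 14, Exercise 14.8 (a), p. 438] -/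
@[simp]
theorem omega_basisVector_two (x : E3) : omega x (basisVector 2) = 2 * x 1 := by
  simp [omega_apply, Fin.ext_iff]

/-- `g_x(∂ₜ, w) = −ω_x(w)`: contracting with the time axis recovers `−ω`
(O'Neill 1983, Exercise 14.8 (a)). [cite: ONeillSemiRiemannian1983, Ch. 14, Exercise 14.8 (a), p. 438] -/
@[simp]
theorem bilin_basisVector_zero_left (x w : E3) : bilin x (basisVector 0) w = -omega x w := by
  simp [bilin_apply, Fin.ext_iff]

/-- `g_x(∂ₜ, ∂ₜ) = −1`: the time axis is timelike everywhere (O'Neill 1983, Exercise 14.8 (a)). [cite: ONeillSemiRiemannian1983, Ch. 14, Exercise 14.8 (a), p. 438] -/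
theorem bilin_basisVector_zero (x : E3) : bilin x (basisVector 0) (basisVector 0) = -1 := by
  simp

/-- `g_x` is nondegenerate: testing against `∂ₜ, ∂ₓ, ∂_y` gives `ω_x(v) = v¹ = v² = 0`, so
`v = 0` (O'Neill 1983, Ch. 3, Def. 3.1, for the metric of Exercise 14.8 (a)). [cite: ONeillSemiRiemannian1983, Ch. 14, Exercise 14.8 (a), p. 438] -/
theorem bilin_nondegenerate (x v : E3) (hv : ∀ w, bilin x v w = 0) : v = 0 := by
  have h0 := hv (basisVector 0)
  have h1 := hv (basisVector 1)
  have h2 := hv (basisVector 2)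
  rw [bilin_symm, bilin_basisVector_zero_left, neg_eq_zero] at h0
  rw [bilin_apply, h0, zero_mul, neg_zero, zero_add] at h1 h2
  have hv1 : v 1 = 0 := by simpa using h1
  have hv2 : v 2 = 0 := by simpa using h2
  have hv0 : v 0 = 0 := by
    rw [omega_apply, hv1, hv2] at h0
    linarith
  ext μ
  fin_cases μ
  · simpa using hv0
  · simpa using hv1
  · simpa using hv2

/-- **Lorentzian signature**: the `g_x`-orthogonal complement of a `g_x`-timelike vector is
positive definite (with `p = ω_x(v)`, `P = ω_x(w)`, `a = (v¹, v²)`, `b = (w¹, w²)`: `|a|² < p²`,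
`a·b = pP` and `|b|² ≤ P²` give `p²|b|² ≤ (a·b)² ≤ |a|²|b|²`, so `b = 0`, `P = 0`, `w = 0`).
O'Neill 1983, Ch. 5, Lemma 5.26 (`ℝ³₁`), through the shear `A_x`. [cite: ONeillSemiRiemannian1983, Ch. 5, Lemma 5.26] -/
theorem bilin_pos_of_orthogonal (x v w : E3) (hv : bilin x v v < 0) (hvw : bilin x v w = 0)
    (hw : w ≠ 0) : 0 < bilin x w w := by
  simp only [bilin_apply] at hv hvw ⊢
  set p := omega x v with hp_def
  set P := omega x w with hP_def
  have hp : v 1 * v 1 + v 2 * v 2 < p * p := by linarith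
  have hab : v 1 * w 1 + v 2 * w 2 = p * P := by linarith
  have hCS : (v 1 * w 1 + v 2 * w 2) ^ 2 ≤ (v 1 * v 1 + v 2 * v 2) * (w 1 * w 1 + w 2 * w 2) := by
    nlinarith [sq_nonneg (v 1 * w 2 - v 2 * w 1)]
  by_contra hle
  have hbP : w 1 * w 1 + w 2 * w 2 ≤ P * P := by linarith [not_lt.mp hle]
  have hb0 : w 1 * w 1 + w 2 * w 2 ≤ 0 := by
    by_contra hb'
    have hb : 0 < w 1 * w 1 + w 2 * w 2 := not_le.mp hb'
    have h1 : p * p * (w 1 * w 1 + w 2 * w 2) ≤ p * p * (P * P) :=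
      mul_le_mul_of_nonneg_left hbP (mul_self_nonneg p)
    have h2 : p * p * (P * P) = (v 1 * w 1 + v 2 * w 2) ^ 2 := by rw [hab]; ring
    have h3 : (v 1 * v 1 + v 2 * v 2) * (w 1 * w 1 + w 2 * w 2) <
        p * p * (w 1 * w 1 + w 2 * w 2) := mul_lt_mul_of_pos_right hp hb
    linarith
  have hw1 : w 1 = 0 := by nlinarith [mul_self_nonneg (w 1), mul_self_nonneg (w 2)]
  have hw2 : w 2 = 0 := by nlinarith [mul_self_nonneg (w 1), mul_self_nonneg (w 2)]
  have hp0 : p ≠ 0 := by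
    intro h
    rw [h] at hp
    nlinarith [mul_self_nonneg (v 1), mul_self_nonneg (v 2)]
  have hP : P = 0 := by
    have h : p * P = 0 := by rw [← hab, hw1, hw2]; ring
    rcases mul_eq_zero.mp h with h | h
    · exact absurd h hp0
    · exact h
  have hw0 : w 0 = 0 := by
    rw [hP_def, omega_apply, hw1, hw2] at hP
    linarith
  apply hw
  ext μ
  fin_cases μ
  · simpa using hw0
  · simpa using hw1
  · simpa using hw2

/-- `x ↦ g_x` is a polynomial (degree two) map `E3 → (E3 →L E3 →L ℝ)`, hence analytic
(O'Neill 1983, Exercise 14.8 (a); Mathlib `ContDiff.smulRight`). [cite: ONeillSemiRiemannian1983, Ch. 14, Exercise 14.8 (a), p. 438] -/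
theorem contDiff_bilin : ContDiff ℝ ω bilin := by
  have ht : ContDiff ℝ ω (fun x ↦ tmul (-omega x) (omega x)) :=
    contDiff_omega.neg.smulRight contDiff_omega
  unfold bilin
  exact (ht.add contDiff_const).add contDiff_const

/-! ### Sections of the bundle of bilinear forms on a normed space -/

section BilinSection

variable {F : Type*} [NormedAddCommGroup F] [NormedSpace ℝ F]

/-- **A field of bilinear forms `s : F → (F →L F →L ℝ)` on a normed space `F` is `C^n` as a
section of `Hom(TF, Hom(TF, ℝ))` as soon as it is `C^n` as a map**: the preferred trivializations
of `TF` are the identity, so the coordinate expression of the section (`Bundle.contMDiffAt_section`,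
`hom_trivializationAt_apply`) is `s` itself (compare `contMDiff_vectorSpace_iff_contDiff`). [folklore] -/
theorem contMDiff_bilinSection {n : ℕ∞ω} {s : F → F →L[ℝ] F →L[ℝ] ℝ} (hs : ContDiff ℝ n s) :
    ContMDiff 𝓘(ℝ, F) (𝓘(ℝ, F).prod 𝓘(ℝ, F →L[ℝ] F →L[ℝ] ℝ)) n
      (fun x : F ↦ TotalSpace.mk' (F →L[ℝ] F →L[ℝ] ℝ)
        (E := fun y : F ↦ TangentSpace 𝓘(ℝ, F) y →L[ℝ] TangentSpace 𝓘(ℝ, F) y →L[ℝ] ℝ)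
        x (s x)) := by
  intro x₀
  rw [contMDiffAt_section]
  refine (hs.contMDiff x₀).congr_of_eventuallyEq (Filter.Eventually.of_forall fun y ↦ ?_)
  show ((trivializationAt (F →L[ℝ] F →L[ℝ] ℝ)
    (fun x : F ↦ TangentSpace 𝓘(ℝ, F) x →L[ℝ] TangentSpace 𝓘(ℝ, F) x →L[ℝ] ℝ) x₀) ⟨y, s y⟩).2
      = s y
  ext v w
  rw [hom_trivializationAt_apply]
  simp only [ContinuousLinearMap.inCoordinates, ContinuousLinearMap.coe_comp,
    Function.comp_apply]
  simp
  rw [hom_trivializationAt_apply]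
  simp [ContinuousLinearMap.inCoordinates]
  rfl

end BilinSection

/-! ### The Lorentz manifold `(ℝ³, g, ∂ₜ)` -/

/-- **O'Neill's Exercise 14.8 (a): a Lorentz metric on `ℝ³` with closed timelike curves**, as an
analytic `LorentzianMetric` on `E3` (model `𝓘(ℝ, E3)`): the section `x ↦ g_x = −ω_x ⊗ ω_x +
dx ⊗ dx + dy ⊗ dy`. O'Neill 1983, Ch. 14, Exercise 14.8 (a), p. 438; Hawking–Ellis 1973, §5.7. [cite: ONeillSemiRiemannian1983, Ch. 14, Exercise 14.8 (a), p. 438] -/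
def metric : LorentzianMetric 𝓘(ℝ, E3) ω E3 where
  val x := bilin x
  symm x := bilin_symm x
  nondegenerate x := bilin_nondegenerate x
  contMDiff := contMDiff_bilinSection contDiff_bilin
  exists_timelike x := ⟨basisVector 0, (bilin_basisVector_zero x).trans_lt neg_one_lt_zero⟩
  pos_of_orthogonal x := bilin_pos_of_orthogonal x

/-- The metric at any point is `bilin x` (O'Neill 1983, Exercise 14.8 (a)). [cite: ONeillSemiRiemannian1983, Ch. 14, Exercise 14.8 (a), p. 438] -/
@[simp]
theorem metric_val (x : E3) : metric.val x = bilin x := rfl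

/-- The **time orientation `∂ₜ`** of `(ℝ³, g)`: a constant (hence analytic) vector field with
`g(∂ₜ, ∂ₜ) = −1`. O'Neill 1983, Ch. 5, Lemma 5.32 (time orientation = timelike vector field);
Exercise 14.8 (a). [cite: ONeillSemiRiemannian1983, Ch. 5, Lemma 5.32] -/
def timeOrientation : TimeOrientation metric where
  vectorField _ := basisVector 0
  isTimelike x := (bilin_basisVector_zero x).trans_lt neg_one_lt_zero
  contMDiff := contMDiff_vectorSpace_iff_contDiff.mpr contDiff_const

/-! ### The closed timelike curve -/

/-- The **unit circle in the slice `t = 0`**, `γ(s) = (0, cos s, sin s)`, a closed curve in `ℝ³`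
(period `2π`) along which the light cones of `g` have tipped past the horizontal: it is timelike.
O'Neill 1983, Ch. 14, Exercise 14.8 (a), p. 438. [cite: ONeillSemiRiemannian1983, Ch. 14, Exercise 14.8 (a), p. 438] -/
def circle (s : ℝ) : E3 := Real.cos s • basisVector 1 + Real.sin s • basisVector 2

/-- The velocity field `γ'(s) = (0, −sin s, cos s) = ∂_φ` of the unit circle (O'Neill 1983, Exercise 14.8 (a)). [cite: ONeillSemiRiemannian1983, Ch. 14, Exercise 14.8 (a), p. 438] -/
def circleVelocity (s : ℝ) : E3 := (-Real.sin s) • basisVector 1 + Real.cos s • basisVector 2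

/-- The time coordinate of `γ(s)` vanishes: the circle lies in the slice `t = 0` (O'Neill 1983, Exercise 14.8 (a)). [folklore] -/
@[simp] theorem circle_apply_zero (s : ℝ) : circle s 0 = 0 := by simp [circle, Fin.ext_iff]

/-- `x(γ(s)) = cos s` (O'Neill 1983, Exercise 14.8 (a)). [folklore] -/
@[simp] theorem circle_apply_one (s : ℝ) : circle s 1 = Real.cos s := by simp [circle, Fin.ext_iff]

/-- `y(γ(s)) = sin s` (O'Neill 1983, Exercise 14.8 (a)). [folklore] -/
@[simp] theorem circle_apply_two (s : ℝ) : circle s 2 = Real.sin s := by simp [circle, Fin.ext_iff]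

/-- `dt(γ'(s)) = 0` (O'Neill 1983, Exercise 14.8 (a)). [folklore] -/
@[simp] theorem circleVelocity_apply_zero (s : ℝ) : circleVelocity s 0 = 0 := by
  simp [circleVelocity, Fin.ext_iff]

/-- `dx(γ'(s)) = −sin s` (O'Neill 1983, Exercise 14.8 (a)). [folklore] -/
@[simp] theorem circleVelocity_apply_one (s : ℝ) : circleVelocity s 1 = -Real.sin s := by
  simp [circleVelocity, Fin.ext_iff]

/-- `dy(γ'(s)) = cos s` (O'Neill 1983, Exercise 14.8 (a)). [folklore] -/
@[simp] theorem circleVelocity_apply_two (s : ℝ) : circleVelocity s 2 = Real.cos s := by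
  simp [circleVelocity, Fin.ext_iff]

/-- `γ(0) = ∂ₓ = (0, 1, 0)` (O'Neill 1983, Exercise 14.8 (a)). [cite: ONeillSemiRiemannian1983, Ch. 14, Exercise 14.8 (a), p. 438] -/
theorem circle_zero : circle 0 = basisVector 1 := by
  simp [circle]

/-- `γ(2π) = (0, 1, 0) = γ(0)`: the curve is closed. O'Neill 1983, Exercise 14.8 (a). [cite: ONeillSemiRiemannian1983, Ch. 14, Exercise 14.8 (a), p. 438] -/
theorem circle_two_pi : circle (2 * Real.pi) = basisVector 1 := by
  simp [circle]

/-- `γ` is differentiable with derivative `γ'` (O'Neill 1983, Exercise 14.8 (a)). [cite: ONeillSemiRiemannian1983, Ch. 14, Exercise 14.8 (a), p. 438] -/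
theorem hasDerivAt_circle (s : ℝ) : HasDerivAt circle (circleVelocity s) s :=
  ((Real.hasDerivAt_cos s).smul_const (basisVector 1)).add
    ((Real.hasDerivAt_sin s).smul_const (basisVector 2))

/-- `γ` is differentiable in the manifold sense, `dγ_s = (1 ↦ γ'(s))` (O'Neill 1983, Exercise 14.8 (a)). [cite: ONeillSemiRiemannian1983, Ch. 14, Exercise 14.8 (a), p. 438] -/
theorem hasMFDerivAt_circle (s : ℝ) :
    HasMFDerivAt 𝓘(ℝ, ℝ) 𝓘(ℝ, E3) circle s
      (ContinuousLinearMap.toSpanSingleton ℝ (circleVelocity s)) :=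
  hasMFDerivAt_iff_hasFDerivAt.mpr (hasDerivAt_circle s).hasFDerivAt

/-- The (manifold) velocity of `γ` is `γ'(s) = (0, −sin s, cos s)` (O'Neill 1983, Exercise 14.8 (a)). [cite: ONeillSemiRiemannian1983, Ch. 14, Exercise 14.8 (a), p. 438] -/
theorem velocity_circle (s : ℝ) : velocity 𝓘(ℝ, E3) circle s = circleVelocity s := by
  have h : ContinuousLinearMap.toSpanSingleton ℝ (circleVelocity s) (1 : ℝ) = circleVelocity s := by
    rw [ContinuousLinearMap.toSpanSingleton_apply, one_smul]
  unfold velocity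
  rw [(hasMFDerivAt_circle s).mfderiv]
  exact h

/-- `ω_γ(s)(γ'(s)) = 2 (cos² s + sin² s) = 2` (O'Neill 1983, Exercise 14.8 (a)). [cite: ONeillSemiRiemannian1983, Ch. 14, Exercise 14.8 (a), p. 438] -/
theorem omega_circle_circleVelocity (s : ℝ) : omega (circle s) (circleVelocity s) = 2 := by
  simp only [omega_apply, circle_apply_one, circle_apply_two, circleVelocity_apply_zero,
    circleVelocity_apply_one, circleVelocity_apply_two]
  linear_combination 2 * Real.sin_sq_add_cos_sq s

/-- **The circle is timelike**: `g(γ', γ') = −4 + sin² s + cos² s = −3`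
(O'Neill 1983, Exercise 14.8 (a)). [cite: ONeillSemiRiemannian1983, Ch. 14, Exercise 14.8 (a), p. 438] -/
theorem bilin_circleVelocity (s : ℝ) :
    bilin (circle s) (circleVelocity s) (circleVelocity s) = -3 := by
  rw [bilin_apply, omega_circle_circleVelocity]
  simp only [circleVelocity_apply_one, circleVelocity_apply_two]
  linear_combination Real.sin_sq_add_cos_sq s

/-- **The circle is future-directed** for `∂ₜ`: `g(∂ₜ, γ') = −ω(γ') = −2 < 0`
(O'Neill 1983, Exercise 14.8 (a); Ch. 5, p. 145 for timecones). [cite: ONeillSemiRiemannian1983, Ch. 14, Exercise 14.8 (a), p. 438] -/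
theorem bilin_basisVector_zero_circleVelocity (s : ℝ) :
    bilin (circle s) (basisVector 0) (circleVelocity s) = -2 := by
  rw [bilin_basisVector_zero_left, omega_circle_circleVelocity]

/-- **The unit circle `t = 0`, `x² + y² = 1` is a future-directed timelike curve** of
`(ℝ³, g, ∂ₜ)` on every parameter set (it is differentiable everywhere with
`g(γ', γ') = −3 < 0` and `g(∂ₜ, γ') = −2 < 0`). O'Neill 1983, Ch. 14, Exercise 14.8 (a), p. 438. [cite: ONeillSemiRiemannian1983, Ch. 14, Exercise 14.8 (a), p. 438] -/
theorem isFutureTimelikeCurveOn_circle (S : Set ℝ) :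
    metric.IsFutureTimelikeCurveOn timeOrientation circle S := by
  intro s _
  have hvel := velocity_circle s
  have ht : metric.IsTimelike (velocity 𝓘(ℝ, E3) circle s) := by
    show bilin (circle s) (velocity 𝓘(ℝ, E3) circle s) (velocity 𝓘(ℝ, E3) circle s) < 0
    rw [hvel, bilin_circleVelocity]
    norm_num
  have hf : metric.val (circle s) (timeOrientation.vectorField (circle s))
      (velocity 𝓘(ℝ, E3) circle s) < 0 := by
    show bilin (circle s) (basisVector 0) (velocity 𝓘(ℝ, E3) circle s) < 0
    rw [hvel, bilin_basisVector_zero_circleVelocity]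
    norm_num
  exact ⟨(hasMFDerivAt_circle s).mdifferentiableAt, ht, ht.isCausal, hf⟩

/-! ### Refutation of the universal closure of the chronology condition -/

/-- **`(ℝ³, g, ∂ₜ)` violates the chronology condition**: the unit circle in `t = 0` is a closed
timelike curve, `γ(0) = γ(2π)`. O'Neill 1983, Ch. 14, p. 407 (chronology condition) and
Exercise 14.8 (a), p. 438; compare Lemma 14.10 (compact spacetimes) and Hawking–Ellis 1973, §5.7
(Gödel). [cite: ONeillSemiRiemannian1983, Ch. 14, p. 407 and Exercise 14.8 (a), p. 438] -/
theorem not_isChronological : ¬ metric.IsChronological timeOrientation := fun h ↦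
  h circle 0 (2 * Real.pi) Real.two_pi_pos (isFutureTimelikeCurveOn_circle _)
    (circle_zero.trans circle_two_pi.symm)

/-- Unfolded form: `∂ₓ = (0, 1, 0)` lies in its own chronological future, `∂ₓ ∈ I⁺(∂ₓ)`
(O'Neill 1983, Ch. 14, p. 407: the chronology condition fails at `p` iff `p ∈ I⁺(p)`). [cite: ONeillSemiRiemannian1983, Ch. 14, p. 407] -/
theorem basisVector_one_mem_chronologicalFuture_self :
    basisVector 1 ∈ metric.chronologicalFuture timeOrientation {basisVector 1} :=
  ⟨basisVector 1, rfl, circle, 0, 2 * Real.pi, Real.two_pi_pos, isFutureTimelikeCurveOn_circle _,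
    circle_zero, circle_two_pi⟩

end ChronologyViolation

/-- **`LorentzianMetric.IsChronological` is a causality *condition* (O'Neill's definition,
Ch. 14, p. 407), not a named fact: its universal closure — the statement a discharge
`IsChronological_holds` would have to prove — is false.** Witness: O'Neill's Exercise 14.8 (a)
metric on `ℝ³` (`ChronologyViolation.not_isChronological`); every compact spacetime is another
(O'Neill 1983, Lemma 14.10). [cite: ONeillSemiRiemannian1983, Ch. 14, p. 407 and Exercise 14.8 (a), p. 438] -/
theorem LorentzianMetric.not_forall_isChronological :
    ¬ ∀ {E : Type} [NormedAddCommGroup E] [NormedSpace ℝ E] {H : Type} [TopologicalSpace H]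
        {I : ModelWithCorners ℝ E H} {n : ℕ∞ω} {M : Type} [TopologicalSpace M] [ChartedSpace H M]
        [IsManifold I ∞ M] (g : LorentzianMetric I n M) (τ : TimeOrientation g),
        g.IsChronological τ :=
  fun h ↦ ChronologyViolation.not_isChronological (h ChronologyViolation.metric
    ChronologyViolation.timeOrientation)

end Literature.Geometry.Lorentzian

end
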